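import Literature.AlgebraicGeometry.HodgeTheory.FermatShiodaConditionSmall
import HarnessLib

/-!
# Aoki's `5`-standard sextuples: Shioda's condition `(P⁴ₘ)` fails for `m = 25` and `m = 35`

Family `hodge`, layer `Literature/AlgebraicGeometry/HodgeTheory`. Sequel of `FermatShiodaCondition` /
`FermatShiodaConditionSmall` (Shioda's semigroup `Mₘ` as `FermatCharacter.IsHodgeMultiset`, the
decomposability notions and `ShiodaCondition m = (Pₘ)`, `ShiodaConditionUpTo m n = (Pⁿₘ)`).
Everything here is PROVED (kernel computations); no definition and no named fact is introduced.

## What is proved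

For the degrees `m = 25` and `m = 35` — both coprime to `6` — the `5`-STANDARD SEXTUPLE
`σ_{5,1} = {1, 1+d, 1+2d, 1+3d, 1+4d, -5}`, `d = m/5` (Aoki, J. Math. Soc. Japan 39 (1987), §1
p. 387: for an odd prime `p ∣ m`, `d = m/p`, the standard elements
`σ_{p,i} = (i, i+d, …, i+(p-1)d, -pi)`, `d/(i,d) > 2`, are Hodge characters of `X^{p-1}ₘ`; for
`p = 5` they live on the Fermat FOURFOLD `X⁴ₘ`), i.e.

* `{1, 6, 11, 16, 21, 20} ⊂ ℤ/25` and `{1, 8, 15, 22, 29, 30} ⊂ ℤ/35`,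

is a Hodge multiset (`isHodgeMultiset_fiveStandard_twentyfive/thirtyfive`: `Σ ⟨t aᵢ⟩ = 3m` for
every unit `t`) all of whose proper non-empty sub-multisets have NON-ZERO sum
(`sum_ne_zero_of_mem_powerset_fiveStandard_…`: no pair `{a, -a}`, no zero-sum triple), hence is
neither decomposable nor semi-decomposable, and it is not quasi-decomposable either
(`not_isQuasiDecomposable_fiveStandard_…`: `σ + {e, -e} = t + u` with `t, u ∈ Mₘ` different from
`σ` is impossible — checked over all `e ∈ ℤ/m` and all sub-multisets `t`, the Hodge condition being
tested on six units). Consequently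

* `not_shiodaConditionUpTo_twentyfive_four : ¬ ShiodaConditionUpTo 25 4`,
  `not_shiodaCondition_twentyfive : ¬ ShiodaCondition 25` — da Silva, arXiv:2101.04739 §2:
  "condition (Pₘ) is not always true, it's false for `m = 25` for example" (his table: `φ(25) = 3`,
  an indecomposable of length `3`, i.e. on the fourfold);
* `not_shiodaConditionUpTo_thirtyfive_four : ¬ ShiodaConditionUpTo 35 4`,
  `not_shiodaCondition_thirtyfive : ¬ ShiodaCondition 35` (same mechanism, `d = 7`).

## Why this is recorded (audit of da Silva 2021, Thm. 3.3)

The named fact `daSilva2021_hodgeClasses_algebraic_fermatFourfold_coprime_six` (file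
`FermatFourfoldHodgeDaSilva`) transcribes da Silva's Thm. 3.3, "if `m` is coprime to `6`, then the
Hodge conjecture is true for all Fermat fourfolds `X⁴ₘ`", whose entire printed proof is: Shioda's
inductive structure (da Silva Thm. 2.2 = Shioda, Math. Ann. 245 (1979) Thm. I–II) with `n = 4`,
`r = s = 2`, plus Lemma 3.2 ((a) `𝔅²ₘ` consists of pairs for `(m,6) = 1` — Shioda 1982 / Aoki 1983,
quoted in Aoki–Shioda 1983 §2 "Theorem (𝔅²ₘ)(i)"; (b) Aoki 1991 on `X¹ₘ × X¹ₘ`). On eigenlines that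
argument reaches `V(α)`, `α ∈ 𝔅⁴ₘ`, only when the multiset of `α` is a union of three pairs
(type I with inputs from `𝔅²ₘ × 𝔅²ₘ`) or splits into two zero-sum triples (type II,
`X¹ₘ × X¹ₘ`) — i.e. only inside Shioda's condition `(P⁴ₘ)`. The theorems of this file show that for
`m = 25, 35` (coprime to `6`) the Hodge characters `σ_{5,a}` of `X⁴ₘ` lie OUTSIDE `(P⁴ₘ)`: the
printed proof does not cover them (their eigenlines are algebraic by a different theorem, Aoki 1987
Thm. 2-1, the explicit subvariety `Y ⊂ X⁴ₘ`; tree: `Aoki1987_claim_pStandard`), and for general `m`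
coprime to `6` it silently needs the classification `𝔅⁴ₘ = 𝔇⁴ₘ ∪ {σ_{5,a}}`, which the source
neither states nor proves and which is not found in the literature consulted here (Shioda 1979,
Aoki–Shioda 1983, Aoki 1987, da Silva 2021; a machine enumeration outside the tree confirms it for
every `m ≤ 100` coprime to `6`; the general-`m` statement is the crux `K3Exhaustion` of route
`Summit.HodgeConjecture.HodgeConjecture.Theses.DerivedTorelliFermat`). Nothing here asserts or
refutes the Hodge conjecture for any `X⁴ₘ`.

## General degree (appended): `σ_{p,a}` is a Hodge character for every `m`; for `m = 5d`, `(d,6) = 1`, `d > 1` it is neither decomposable nor semi-decomposable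

Sections `GeneralDegree` and `FiveStandardGeneral` below replace the two kernel computations by
proofs valid for all degrees:

* `range_map_eq_filter_of_dvd` — for `p ∣ m`, `d = m/p`, a unit `t` and any `b`, the twisted
  progression `{b + i (t d) : i < p}` is the fibre `{x ≡ b (mod d)}` of `ℤ/m → ℤ/d` (a unit
  permutes the coset); `sum_val_filter_of_dvd`: `Σ ⟨x⟩` over that fibre is `p r + d p(p-1)/2`,
  `r = ⟨b⟩ mod d` (the tree's `KoblitzOgus.sum_fiber_eq_sum_range`).
* `isHodgeMultiset_pStandard` — **for `p = 2r+1` odd, `p ∣ m` and `p a ≠ 0`, Aoki's standard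
  multiset `{a + k d : k < p} + {-pa}` is a Hodge multiset** (Aoki, Math. Ann. 266 (1983) §5
  Prop. 5.1: "Every standard element belongs to `B_m`"; the spelling is the multiset hypothesis of
  the named fact `Aoki1987_claim_pStandard` of `FermatInductiveClaims`): `Σ ⟨t x⟩ = m (p+1)/2`
  for every unit `t`. The prime-power file `FermatHodgeCharactersPrimePow` has this for `m = pᵏ`
  (`isHodgeMultiset_std`); here `m` is arbitrary.
* `isHodgeMultiset_fiveStandard` (`p = 5`, the route spelling `{a, a+d, a+2d, a+3d, a+4d, -(5a)}`
  of `Theses/DerivedTorelliFermat`), `nodup_fiveStandard`, `fiveStandard_add_ne_zero` (no two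
  distinct entries sum to `0`), `fiveStandard_add_add_ne_zero` (no three), hence
  `not_isDecomposable_fiveStandard`, `not_isSemiDecomposable_fiveStandard`, all for `5 ∣ m`,
  `d = m/5 > 1` coprime to `6`, `(⟨a⟩, d) = 1` (reduction mod `d`: the entries go to `ā` (five
  times) and `-5ā`, `ā` a unit of `ℤ/d`), and the summary
  `fiveStandard_hodge_not_decomposable_of_coprime_six` for every `m ≠ 5` coprime to `6` with
  `5 ∣ m`. Quasi-decomposability is NOT treated in general (for `m = 25, 35` it is excluded above by
  computation; in general it would follow from `𝔅²ₘ = 𝔇²ₘ` for `(m,6) = 1`).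

Literature addendum (read after the sections above were first written): N. Aoki, *On some
arithmetic problems related to the Hodge cycles on the Fermat varieties*, Math. Ann. 266 (1983)
23–54, **Thm. A = Thm. A′ (p. 43)**: for `n` even, `𝔅ⁿₘ = 𝔇ⁿₘ` iff `m` is prime or `4` or every
prime divisor of `m` is `≥ n + 3`; with Ran/Shioda (p. 24: "if `𝔅ⁿₘ = 𝔇ⁿₘ`, then the Hodge
conjecture for `Xⁿₘ` is true") this PROVES the Hodge conjecture for `X⁴ₘ` when `(m, 30) = 1`, and
shows `𝔅⁴ₘ ≠ 𝔇⁴ₘ` for every composite `m` with `5 ∣ m` (§7: `σ_{5,1} ∈ 𝔅⁴ₘ ∖ 𝔇⁴ₘ`, the family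
formalised below). Aoki adds (p. 24) that the structure of `𝔅ⁿₘ` for `n > 2` is undetermined, and
(J. Math. Soc. Japan 39 (1987), p. 388) that the semi-standard classes are not known to be
algebraic: the statement of da Silva's Thm. 3.3 for `5 ∣ m`, `m` not a prime power, is therefore
not covered by any proof in the literature consulted (its own printed proof being the two-line
reduction discussed above).

## References

* [Aoki1983] N. Aoki, On some arithmetic problems related to the Hodge cycles on the Fermat
  varieties, Math. Ann. 266 (1983) 23–54: Thm. A (p. 24), §5 Prop. 5.1 and the standard elements
  (p. 36), Thm. D (p. 38), Thm. A′ and its proof (§7, p. 43) (page images of the GDZ scan read).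
* [Aoki1987] N. Aoki, Some new algebraic cycles on Fermat varieties, J. Math. Soc. Japan 39 (1987)
  385–396, §1 p. 387 (standard elements `σ_{p,i}`; Thm. 1-2, 1-3), Thm. 2-1 and Cor. 2-3 (p. 388).
* [Shioda1979PJA] T. Shioda, The Hodge conjecture and the Tate conjecture for Fermat varieties,
  Proc. Japan Acad. 55A (1979) 111–114, §1 Definition (i)–(iii), conditions `(Pⁿₘ)`, `(Pⁿₘ)'`.
* [daSilva2021HodgeFermat] G. da Silva Jr., Notes on the Hodge Conjecture for Fermat Varieties,
  Experimental Results 2 (2021), arXiv:2101.04739, §2 (remark before Thm. 2.8: `(P₂₅)` false;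
  Def. 2.4), §3 Thm. 3.3 and its proof, table of `φ(m)` (text read, pp. 4–6 of the arXiv version).
-/

open Multiset

namespace Literature.AlgebraicGeometry.HodgeTheory

namespace FermatCharacter

/-! ### `m = 25`: the sextuple `σ_{5,1} = {1, 6, 11, 16, 21, 20}` (`d = 5`) -/

section TwentyFive

/-- **`σ_{5,1}` is a Hodge character of `X⁴₂₅`**: all entries non-zero, sum zero, and
`Σᵢ ⟨t aᵢ⟩ = 75 = 3 · 25` for every unit `t` of `ℤ/25` (the standard elements belong to `𝔅ₘ`).
[cite: Aoki1987, §1 p. 387 (standard elements of 𝔅ₘ)] [cite: Shioda1979PJA, §1 eq. (2)] -/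
theorem isHodgeMultiset_fiveStandard_twentyfive : IsHodgeMultiset ({1, 6, 11, 16, 21, 20} : Multiset (ZMod 25)) := by
  unfold IsHodgeMultiset mNormSum; decide +kernel

/-- Every proper non-empty sub-multiset of `σ_{5,1} ⊂ ℤ/25` has non-zero sum: in particular the
sextuple contains no pair `{a, -a}` and no zero-sum triple. [cite: Aoki1987, §1 p. 387 (σ_{p,i})] -/
theorem sum_ne_zero_of_mem_powerset_fiveStandard_twentyfive :
    ∀ t ∈ Multiset.powerset ({1, 6, 11, 16, 21, 20} : Multiset (ZMod 25)), t ≠ 0 → ({1, 6, 11, 16, 21, 20} : Multiset (ZMod 25)) - t ≠ 0 → t.sum ≠ 0 := by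
  decide +kernel

/-- `σ_{5,1} ⊂ ℤ/25` is **not decomposable** (`ξ = ξ' + ξ''` in `M₂₅` is impossible: a summand
would be a proper non-empty sub-multiset with zero sum). [cite: Shioda1979PJA, §1 Definition (i)]
[cite: daSilva2021HodgeFermat, §2 (remark before Thm. 2.8: "(Pₘ) … is false for m = 25") and table φ(25) = 3] -/
theorem not_isDecomposable_fiveStandard_twentyfive : ¬ IsDecomposable ({1, 6, 11, 16, 21, 20} : Multiset (ZMod 25)) := by
  rintro ⟨t, u, ht0, hu0, ht, -, heq⟩
  have htle : t ≤ ({1, 6, 11, 16, 21, 20} : Multiset (ZMod 25)) := heq ▸ Multiset.le_add_right t u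
  have hu : ({1, 6, 11, 16, 21, 20} : Multiset (ZMod 25)) - t = u := by rw [heq, add_tsub_cancel_left]
  exact sum_ne_zero_of_mem_powerset_fiveStandard_twentyfive t (Multiset.mem_powerset.2 htle) ht0
    (hu ▸ hu0) ht.1.2

/-- `σ_{5,1} ⊂ ℤ/25` is **not semi-decomposable** (no zero-sum triple).
[cite: Shioda1979PJA, §1 Definition (iii)] -/
theorem not_isSemiDecomposable_fiveStandard_twentyfive : ¬ IsSemiDecomposable ({1, 6, 11, 16, 21, 20} : Multiset (ZMod 25)) := by
  rintro ⟨t, u, ht3, hu3, hts, -, heq⟩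
  have htle : t ≤ ({1, 6, 11, 16, 21, 20} : Multiset (ZMod 25)) := heq ▸ Multiset.le_add_right t u
  have hu : ({1, 6, 11, 16, 21, 20} : Multiset (ZMod 25)) - t = u := by rw [heq, add_tsub_cancel_left]
  have ht0 : t ≠ 0 := by rintro rfl; simp at ht3
  have hu0 : u ≠ 0 := by rintro rfl; simp at hu3
  exact sum_ne_zero_of_mem_powerset_fiveStandard_twentyfive t (Multiset.mem_powerset.2 htle) ht0
    (hu ▸ hu0) hts

set_option maxHeartbeats 1600000 in
/-- The arithmetic heart of "`σ_{5,1}` is **not quasi-decomposable** in `M₂₅`": for every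
`e ∈ ℤ/25` and every splitting `σ + {e, -e} = t + u` into non-empty parts different from `σ`, one
of `t`, `u` violates a condition every Hodge multiset satisfies (entries non-zero, sum zero,
`2 Σ⟨c a⟩ = 25 · #` for the units `c = 1, 3, 4, 6, 9, 11`). Kernel computation, one residue `e` at a time, over the `25 · 2⁸` cases.
[cite: daSilva2021HodgeFermat, Def. 2.4] [cite: Shioda1979PJA, §1 Definition (ii)] -/
theorem fiveStandard_twentyfive_key :
    ∀ e : ZMod 25, ∀ t ∈ Multiset.powerset (({1, 6, 11, 16, 21, 20} : Multiset (ZMod 25)) + {e, -e}),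
      ¬ (t ≠ 0 ∧ ({1, 6, 11, 16, 21, 20} : Multiset (ZMod 25)) + {e, -e} - t ≠ 0 ∧ t ≠ ({1, 6, 11, 16, 21, 20} : Multiset (ZMod 25)) ∧ ({1, 6, 11, 16, 21, 20} : Multiset (ZMod 25)) + {e, -e} - t ≠ ({1, 6, 11, 16, 21, 20} : Multiset (ZMod 25)) ∧
          ((∀ a ∈ t, a ≠ 0) ∧ (t).sum = 0 ∧
            2 * mNormSum ((t).map fun a ↦ (1 : ZMod 25) * a) = 25 * Multiset.card (t) ∧
            2 * mNormSum ((t).map fun a ↦ (3 : ZMod 25) * a) = 25 * Multiset.card (t) ∧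
            2 * mNormSum ((t).map fun a ↦ (4 : ZMod 25) * a) = 25 * Multiset.card (t) ∧
            2 * mNormSum ((t).map fun a ↦ (6 : ZMod 25) * a) = 25 * Multiset.card (t) ∧
            2 * mNormSum ((t).map fun a ↦ (9 : ZMod 25) * a) = 25 * Multiset.card (t) ∧
            2 * mNormSum ((t).map fun a ↦ (11 : ZMod 25) * a) = 25 * Multiset.card (t)) ∧
          ((∀ a ∈ ({1, 6, 11, 16, 21, 20} : Multiset (ZMod 25)) + {e, -e} - t, a ≠ 0) ∧ (({1, 6, 11, 16, 21, 20} : Multiset (ZMod 25)) + {e, -e} - t).sum = 0 ∧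
            2 * mNormSum ((({1, 6, 11, 16, 21, 20} : Multiset (ZMod 25)) + {e, -e} - t).map fun a ↦ (1 : ZMod 25) * a) = 25 * Multiset.card (({1, 6, 11, 16, 21, 20} : Multiset (ZMod 25)) + {e, -e} - t) ∧
            2 * mNormSum ((({1, 6, 11, 16, 21, 20} : Multiset (ZMod 25)) + {e, -e} - t).map fun a ↦ (3 : ZMod 25) * a) = 25 * Multiset.card (({1, 6, 11, 16, 21, 20} : Multiset (ZMod 25)) + {e, -e} - t) ∧
            2 * mNormSum ((({1, 6, 11, 16, 21, 20} : Multiset (ZMod 25)) + {e, -e} - t).map fun a ↦ (4 : ZMod 25) * a) = 25 * Multiset.card (({1, 6, 11, 16, 21, 20} : Multiset (ZMod 25)) + {e, -e} - t) ∧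
            2 * mNormSum ((({1, 6, 11, 16, 21, 20} : Multiset (ZMod 25)) + {e, -e} - t).map fun a ↦ (6 : ZMod 25) * a) = 25 * Multiset.card (({1, 6, 11, 16, 21, 20} : Multiset (ZMod 25)) + {e, -e} - t) ∧
            2 * mNormSum ((({1, 6, 11, 16, 21, 20} : Multiset (ZMod 25)) + {e, -e} - t).map fun a ↦ (9 : ZMod 25) * a) = 25 * Multiset.card (({1, 6, 11, 16, 21, 20} : Multiset (ZMod 25)) + {e, -e} - t) ∧
            2 * mNormSum ((({1, 6, 11, 16, 21, 20} : Multiset (ZMod 25)) + {e, -e} - t).map fun a ↦ (11 : ZMod 25) * a) = 25 * Multiset.card (({1, 6, 11, 16, 21, 20} : Multiset (ZMod 25)) + {e, -e} - t))) := by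
  intro e
  obtain ⟨k, hk, rfl⟩ : ∃ k < 25, ((k : ℕ) : ZMod 25) = e :=
    ⟨e.val, e.val_lt, ZMod.natCast_zmod_val e⟩
  interval_cases k <;> decide +kernel

/-- A Hodge multiset mod `25` satisfies the finitely many conditions tested in
`fiveStandard_twentyfive_key` (the norm equations at the units `1, 3, 4, 6, 9, 11`).
[cite: Shioda1979PJA, §1 eq. (2)] -/
theorem IsHodgeMultiset.conditions_twentyfive {v : Multiset (ZMod 25)} (hv : IsHodgeMultiset v) :
    (∀ a ∈ v, a ≠ 0) ∧ v.sum = 0 ∧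
      2 * mNormSum (v.map fun a ↦ (1 : ZMod 25) * a) = 25 * Multiset.card v ∧
      2 * mNormSum (v.map fun a ↦ (3 : ZMod 25) * a) = 25 * Multiset.card v ∧
      2 * mNormSum (v.map fun a ↦ (4 : ZMod 25) * a) = 25 * Multiset.card v ∧
      2 * mNormSum (v.map fun a ↦ (6 : ZMod 25) * a) = 25 * Multiset.card v ∧
      2 * mNormSum (v.map fun a ↦ (9 : ZMod 25) * a) = 25 * Multiset.card v ∧
      2 * mNormSum (v.map fun a ↦ (11 : ZMod 25) * a) = 25 * Multiset.card v := by
  have h1 := hv.2 (Units.mkOfMulEqOne 1 1 (by decide))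
  have h3 := hv.2 (Units.mkOfMulEqOne 3 17 (by decide))
  have h4 := hv.2 (Units.mkOfMulEqOne 4 19 (by decide))
  have h6 := hv.2 (Units.mkOfMulEqOne 6 21 (by decide))
  have h9 := hv.2 (Units.mkOfMulEqOne 9 14 (by decide))
  have h11 := hv.2 (Units.mkOfMulEqOne 11 16 (by decide))
  simp only [Units.val_mkOfMulEqOne] at h1 h3 h4 h6 h9 h11
  exact ⟨hv.1.1, hv.1.2, h1, h3, h4, h6, h9, h11⟩

/-- `σ_{5,1} ⊂ ℤ/25` is **not quasi-decomposable**: there is no `e ≠ 0` with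
`σ + {e, -e} = ξ' + ξ''`, `ξ', ξ'' ∈ M₂₅` both different from `σ`.
[cite: daSilva2021HodgeFermat, Def. 2.4]
[cite: daSilva2021HodgeFermat, §2 (remark before Thm. 2.8: "(Pₘ) … is false for m = 25") and table φ(25) = 3] [cite: Shioda1979PJA, §1 Definition (ii)] -/
theorem not_isQuasiDecomposable_fiveStandard_twentyfive : ¬ IsQuasiDecomposable ({1, 6, 11, 16, 21, 20} : Multiset (ZMod 25)) := by
  rintro ⟨e, -, t, u, ht0, hu0, ht, hu, hts, hus, heq⟩
  have htle : t ≤ ({1, 6, 11, 16, 21, 20} : Multiset (ZMod 25)) + {e, -e} := heq ▸ Multiset.le_add_right t u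
  have hu' : ({1, 6, 11, 16, 21, 20} : Multiset (ZMod 25)) + {e, -e} - t = u := by rw [heq, add_tsub_cancel_left]
  subst hu'
  exact fiveStandard_twentyfive_key e t (Multiset.mem_powerset.2 htle)
    ⟨ht0, hu0, hts, hus, ht.conditions_twentyfive, hu.conditions_twentyfive⟩

/-- **Shioda's condition `(P⁴₂₅)` fails**: the Hodge multiset `σ_{5,1}` of cardinality `6` (a Hodge
character of the Fermat fourfold `X⁴₂₅`, whose degree is coprime to `6`) is neither decomposable,
nor quasi-decomposable, nor semi-decomposable. [cite: Shioda1979PJA, §1 condition (Pⁿₘ)]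
[cite: Aoki1987, §1 p. 387 (σ_{p,i})]
[cite: daSilva2021HodgeFermat, §2 (remark before Thm. 2.8: "(Pₘ) … is false for m = 25") and table φ(25) = 3] -/
theorem not_shiodaConditionUpTo_twentyfive_four : ¬ ShiodaConditionUpTo 25 4 := fun h ↦ by
  rcases h _ isHodgeMultiset_fiveStandard_twentyfive (by decide) (by decide) with hd | hq | hs
  · exact not_isDecomposable_fiveStandard_twentyfive hd
  · exact not_isQuasiDecomposable_fiveStandard_twentyfive hq
  · exact not_isSemiDecomposable_fiveStandard_twentyfive hs

/-- Hence `(P₂₅)` fails. [cite: Shioda1979PJA, §1 conditions (Pⁿₘ), (Pⁿₘ)']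
[cite: daSilva2021HodgeFermat, §2 (remark before Thm. 2.8: "(Pₘ) … is false for m = 25") and table φ(25) = 3] -/
theorem not_shiodaCondition_twentyfive : ¬ ShiodaCondition 25 := fun h ↦
  not_shiodaConditionUpTo_twentyfive_four (shiodaCondition_iff_forall_upTo.1 h 4)

end TwentyFive

/-! ### `m = 35`: the sextuple `σ_{5,1} = {1, 8, 15, 22, 29, 30}` (`d = 7`) -/

section ThirtyFive

/-- **`σ_{5,1}` is a Hodge character of `X⁴₃₅`**: all entries non-zero, sum zero, and
`Σᵢ ⟨t aᵢ⟩ = 105 = 3 · 35` for every unit `t` of `ℤ/35` (the standard elements belong to `𝔅ₘ`).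
[cite: Aoki1987, §1 p. 387 (standard elements of 𝔅ₘ)] [cite: Shioda1979PJA, §1 eq. (2)] -/
theorem isHodgeMultiset_fiveStandard_thirtyfive : IsHodgeMultiset ({1, 8, 15, 22, 29, 30} : Multiset (ZMod 35)) := by
  unfold IsHodgeMultiset mNormSum; decide +kernel

/-- Every proper non-empty sub-multiset of `σ_{5,1} ⊂ ℤ/35` has non-zero sum: in particular the
sextuple contains no pair `{a, -a}` and no zero-sum triple. [cite: Aoki1987, §1 p. 387 (σ_{p,i})] -/
theorem sum_ne_zero_of_mem_powerset_fiveStandard_thirtyfive :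
    ∀ t ∈ Multiset.powerset ({1, 8, 15, 22, 29, 30} : Multiset (ZMod 35)), t ≠ 0 → ({1, 8, 15, 22, 29, 30} : Multiset (ZMod 35)) - t ≠ 0 → t.sum ≠ 0 := by
  decide +kernel

/-- `σ_{5,1} ⊂ ℤ/35` is **not decomposable** (`ξ = ξ' + ξ''` in `M₃₅` is impossible: a summand
would be a proper non-empty sub-multiset with zero sum). [cite: Shioda1979PJA, §1 Definition (i)] -/
theorem not_isDecomposable_fiveStandard_thirtyfive : ¬ IsDecomposable ({1, 8, 15, 22, 29, 30} : Multiset (ZMod 35)) := by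
  rintro ⟨t, u, ht0, hu0, ht, -, heq⟩
  have htle : t ≤ ({1, 8, 15, 22, 29, 30} : Multiset (ZMod 35)) := heq ▸ Multiset.le_add_right t u
  have hu : ({1, 8, 15, 22, 29, 30} : Multiset (ZMod 35)) - t = u := by rw [heq, add_tsub_cancel_left]
  exact sum_ne_zero_of_mem_powerset_fiveStandard_thirtyfive t (Multiset.mem_powerset.2 htle) ht0
    (hu ▸ hu0) ht.1.2

/-- `σ_{5,1} ⊂ ℤ/35` is **not semi-decomposable** (no zero-sum triple).
[cite: Shioda1979PJA, §1 Definition (iii)] -/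
theorem not_isSemiDecomposable_fiveStandard_thirtyfive : ¬ IsSemiDecomposable ({1, 8, 15, 22, 29, 30} : Multiset (ZMod 35)) := by
  rintro ⟨t, u, ht3, hu3, hts, -, heq⟩
  have htle : t ≤ ({1, 8, 15, 22, 29, 30} : Multiset (ZMod 35)) := heq ▸ Multiset.le_add_right t u
  have hu : ({1, 8, 15, 22, 29, 30} : Multiset (ZMod 35)) - t = u := by rw [heq, add_tsub_cancel_left]
  have ht0 : t ≠ 0 := by rintro rfl; simp at ht3
  have hu0 : u ≠ 0 := by rintro rfl; simp at hu3
  exact sum_ne_zero_of_mem_powerset_fiveStandard_thirtyfive t (Multiset.mem_powerset.2 htle) ht0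
    (hu ▸ hu0) hts

set_option maxHeartbeats 1600000 in
/-- The arithmetic heart of "`σ_{5,1}` is **not quasi-decomposable** in `M₃₅`": for every
`e ∈ ℤ/35` and every splitting `σ + {e, -e} = t + u` into non-empty parts different from `σ`, one
of `t`, `u` violates a condition every Hodge multiset satisfies (entries non-zero, sum zero,
`2 Σ⟨c a⟩ = 35 · #` for the units `c = 1, 3, 4, 6, 8, 13`). Kernel computation, one residue `e` at a time, over the `35 · 2⁸` cases.
[cite: daSilva2021HodgeFermat, Def. 2.4] [cite: Shioda1979PJA, §1 Definition (ii)] -/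
theorem fiveStandard_thirtyfive_key :
    ∀ e : ZMod 35, ∀ t ∈ Multiset.powerset (({1, 8, 15, 22, 29, 30} : Multiset (ZMod 35)) + {e, -e}),
      ¬ (t ≠ 0 ∧ ({1, 8, 15, 22, 29, 30} : Multiset (ZMod 35)) + {e, -e} - t ≠ 0 ∧ t ≠ ({1, 8, 15, 22, 29, 30} : Multiset (ZMod 35)) ∧ ({1, 8, 15, 22, 29, 30} : Multiset (ZMod 35)) + {e, -e} - t ≠ ({1, 8, 15, 22, 29, 30} : Multiset (ZMod 35)) ∧
          ((∀ a ∈ t, a ≠ 0) ∧ (t).sum = 0 ∧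
            2 * mNormSum ((t).map fun a ↦ (1 : ZMod 35) * a) = 35 * Multiset.card (t) ∧
            2 * mNormSum ((t).map fun a ↦ (3 : ZMod 35) * a) = 35 * Multiset.card (t) ∧
            2 * mNormSum ((t).map fun a ↦ (4 : ZMod 35) * a) = 35 * Multiset.card (t) ∧
            2 * mNormSum ((t).map fun a ↦ (6 : ZMod 35) * a) = 35 * Multiset.card (t) ∧
            2 * mNormSum ((t).map fun a ↦ (8 : ZMod 35) * a) = 35 * Multiset.card (t) ∧
            2 * mNormSum ((t).map fun a ↦ (13 : ZMod 35) * a) = 35 * Multiset.card (t)) ∧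
          ((∀ a ∈ ({1, 8, 15, 22, 29, 30} : Multiset (ZMod 35)) + {e, -e} - t, a ≠ 0) ∧ (({1, 8, 15, 22, 29, 30} : Multiset (ZMod 35)) + {e, -e} - t).sum = 0 ∧
            2 * mNormSum ((({1, 8, 15, 22, 29, 30} : Multiset (ZMod 35)) + {e, -e} - t).map fun a ↦ (1 : ZMod 35) * a) = 35 * Multiset.card (({1, 8, 15, 22, 29, 30} : Multiset (ZMod 35)) + {e, -e} - t) ∧
            2 * mNormSum ((({1, 8, 15, 22, 29, 30} : Multiset (ZMod 35)) + {e, -e} - t).map fun a ↦ (3 : ZMod 35) * a) = 35 * Multiset.card (({1, 8, 15, 22, 29, 30} : Multiset (ZMod 35)) + {e, -e} - t) ∧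
            2 * mNormSum ((({1, 8, 15, 22, 29, 30} : Multiset (ZMod 35)) + {e, -e} - t).map fun a ↦ (4 : ZMod 35) * a) = 35 * Multiset.card (({1, 8, 15, 22, 29, 30} : Multiset (ZMod 35)) + {e, -e} - t) ∧
            2 * mNormSum ((({1, 8, 15, 22, 29, 30} : Multiset (ZMod 35)) + {e, -e} - t).map fun a ↦ (6 : ZMod 35) * a) = 35 * Multiset.card (({1, 8, 15, 22, 29, 30} : Multiset (ZMod 35)) + {e, -e} - t) ∧
            2 * mNormSum ((({1, 8, 15, 22, 29, 30} : Multiset (ZMod 35)) + {e, -e} - t).map fun a ↦ (8 : ZMod 35) * a) = 35 * Multiset.card (({1, 8, 15, 22, 29, 30} : Multiset (ZMod 35)) + {e, -e} - t) ∧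
            2 * mNormSum ((({1, 8, 15, 22, 29, 30} : Multiset (ZMod 35)) + {e, -e} - t).map fun a ↦ (13 : ZMod 35) * a) = 35 * Multiset.card (({1, 8, 15, 22, 29, 30} : Multiset (ZMod 35)) + {e, -e} - t))) := by
  intro e
  obtain ⟨k, hk, rfl⟩ : ∃ k < 35, ((k : ℕ) : ZMod 35) = e :=
    ⟨e.val, e.val_lt, ZMod.natCast_zmod_val e⟩
  interval_cases k <;> decide +kernel

/-- A Hodge multiset mod `35` satisfies the finitely many conditions tested in
`fiveStandard_thirtyfive_key` (the norm equations at the units `1, 3, 4, 6, 8, 13`).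
[cite: Shioda1979PJA, §1 eq. (2)] -/
theorem IsHodgeMultiset.conditions_thirtyfive {v : Multiset (ZMod 35)} (hv : IsHodgeMultiset v) :
    (∀ a ∈ v, a ≠ 0) ∧ v.sum = 0 ∧
      2 * mNormSum (v.map fun a ↦ (1 : ZMod 35) * a) = 35 * Multiset.card v ∧
      2 * mNormSum (v.map fun a ↦ (3 : ZMod 35) * a) = 35 * Multiset.card v ∧
      2 * mNormSum (v.map fun a ↦ (4 : ZMod 35) * a) = 35 * Multiset.card v ∧
      2 * mNormSum (v.map fun a ↦ (6 : ZMod 35) * a) = 35 * Multiset.card v ∧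
      2 * mNormSum (v.map fun a ↦ (8 : ZMod 35) * a) = 35 * Multiset.card v ∧
      2 * mNormSum (v.map fun a ↦ (13 : ZMod 35) * a) = 35 * Multiset.card v := by
  have h1 := hv.2 (Units.mkOfMulEqOne 1 1 (by decide))
  have h3 := hv.2 (Units.mkOfMulEqOne 3 12 (by decide))
  have h4 := hv.2 (Units.mkOfMulEqOne 4 9 (by decide))
  have h6 := hv.2 (Units.mkOfMulEqOne 6 6 (by decide))
  have h8 := hv.2 (Units.mkOfMulEqOne 8 22 (by decide))
  have h13 := hv.2 (Units.mkOfMulEqOne 13 27 (by decide))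
  simp only [Units.val_mkOfMulEqOne] at h1 h3 h4 h6 h8 h13
  exact ⟨hv.1.1, hv.1.2, h1, h3, h4, h6, h8, h13⟩

/-- `σ_{5,1} ⊂ ℤ/35` is **not quasi-decomposable**: there is no `e ≠ 0` with
`σ + {e, -e} = ξ' + ξ''`, `ξ', ξ'' ∈ M₃₅` both different from `σ`.
[cite: daSilva2021HodgeFermat, Def. 2.4] [cite: Shioda1979PJA, §1 Definition (ii)] -/
theorem not_isQuasiDecomposable_fiveStandard_thirtyfive : ¬ IsQuasiDecomposable ({1, 8, 15, 22, 29, 30} : Multiset (ZMod 35)) := by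
  rintro ⟨e, -, t, u, ht0, hu0, ht, hu, hts, hus, heq⟩
  have htle : t ≤ ({1, 8, 15, 22, 29, 30} : Multiset (ZMod 35)) + {e, -e} := heq ▸ Multiset.le_add_right t u
  have hu' : ({1, 8, 15, 22, 29, 30} : Multiset (ZMod 35)) + {e, -e} - t = u := by rw [heq, add_tsub_cancel_left]
  subst hu'
  exact fiveStandard_thirtyfive_key e t (Multiset.mem_powerset.2 htle)
    ⟨ht0, hu0, hts, hus, ht.conditions_thirtyfive, hu.conditions_thirtyfive⟩

/-- **Shioda's condition `(P⁴₃₅)` fails**: the Hodge multiset `σ_{5,1}` of cardinality `6` (a Hodge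
character of the Fermat fourfold `X⁴₃₅`, whose degree is coprime to `6`) is neither decomposable,
nor quasi-decomposable, nor semi-decomposable. [cite: Shioda1979PJA, §1 condition (Pⁿₘ)]
[cite: Aoki1987, §1 p. 387 (σ_{p,i})] -/
theorem not_shiodaConditionUpTo_thirtyfive_four : ¬ ShiodaConditionUpTo 35 4 := fun h ↦ by
  rcases h _ isHodgeMultiset_fiveStandard_thirtyfive (by decide) (by decide) with hd | hq | hs
  · exact not_isDecomposable_fiveStandard_thirtyfive hd
  · exact not_isQuasiDecomposable_fiveStandard_thirtyfive hq
  · exact not_isSemiDecomposable_fiveStandard_thirtyfive hs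

/-- Hence `(P₃₅)` fails. [cite: Shioda1979PJA, §1 conditions (Pⁿₘ), (Pⁿₘ)'] -/
theorem not_shiodaCondition_thirtyfive : ¬ ShiodaCondition 35 := fun h ↦
  not_shiodaConditionUpTo_thirtyfive_four (shiodaCondition_iff_forall_upTo.1 h 4)

end ThirtyFive

/-! ### General degree: the standard elements `σ_{p,a}` are Hodge multisets (Aoki 1983, Prop. 5.1) -/

section GeneralDegree

open Literature.NumberTheory.Transcendental in
/-- **The twisted progression `{b + i·(t d) : i < p}`, `d = m/p`, `t` a unit, is the fibre
`{x ∈ ℤ/m : x ≡ b (mod d)}` of reduction mod `d`** (as a duplicate-free multiset): multiplication by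
a unit permutes the `p` points of the coset `b + d ℤ/m`. [cite: Aoki1983, §5 p. 36 (σ_{p,i})]
[cite: Aoki1987, §1 p. 387] -/
theorem range_map_eq_filter_of_dvd {m p : ℕ} [NeZero m] (hpm : p ∣ m) (b : ZMod m)
    (t : (ZMod m)ˣ) :
    (Multiset.range p).map
        (fun i : ℕ ↦ b + (i : ZMod m) * ((t : ZMod m) * ((m / p : ℕ) : ZMod m))) =
      (Finset.univ.filter fun x : ZMod m ↦ x.val % (m / p) = b.val % (m / p)).val := by
  classical
  have hm0 : m ≠ 0 := NeZero.ne m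
  have hpd : p * (m / p) = m := Nat.mul_div_cancel' hpm
  have hd0 : m / p ≠ 0 := fun h ↦ hm0 (by rw [← hpd, h, mul_zero])
  have hdm : m / p ∣ m := Dvd.intro_left p hpd
  have hmd : m / (m / p) = p := Nat.div_eq_of_eq_mul_left (Nat.pos_of_ne_zero hd0) hpd.symm
  have hple : p ≤ m := Nat.le_of_dvd (Nat.pos_of_ne_zero hm0) hpm
  have hval : ∀ y : ZMod m, (((m / p : ℕ) : ZMod m) * y).val = (m / p) * (y.val % p) :=
    fun y ↦ KoblitzOgus.val_div_mul hpm y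
  have hcast : ∀ i : ℕ, i < p → (i : ZMod m).val = i := fun i hi ↦
    ZMod.val_natCast_of_lt (lt_of_lt_of_le hi hple)
  have htcop : Nat.Coprime (t : ZMod m).val p :=
    (ZMod.val_coe_unit_coprime t).coprime_dvd_right hpm
  have hrw : ∀ i : ℕ, b + (i : ZMod m) * ((t : ZMod m) * ((m / p : ℕ) : ZMod m)) =
      b + ((m / p : ℕ) : ZMod m) * ((i : ZMod m) * t) := fun i ↦ by ring
  set T := (Multiset.range p).map
    (fun i : ℕ ↦ b + (i : ZMod m) * ((t : ZMod m) * ((m / p : ℕ) : ZMod m))) with hT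
  -- membership in the fibre
  have hmem : ∀ x ∈ T,
      x ∈ (Finset.univ.filter fun x : ZMod m ↦ x.val % (m / p) = b.val % (m / p)).val := by
    intro x hx
    rw [Finset.mem_val, Finset.mem_filter]
    refine ⟨Finset.mem_univ _, ?_⟩
    obtain ⟨i, -, rfl⟩ := Multiset.mem_map.mp hx
    rw [hrw, ZMod.val_add, Nat.mod_mod_of_dvd _ hdm, hval, Nat.add_mul_mod_self_left]
  -- no duplicates
  have hnodup : T.Nodup := by
    refine (Multiset.nodup_range p).map_on fun i hi j hj hij ↦ ?_
    rw [Multiset.mem_range] at hi hj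
    rw [hrw, hrw] at hij
    have h1 := congrArg ZMod.val (add_left_cancel hij)
    rw [hval, hval] at h1
    have h2 : ((i : ZMod m) * t).val % p = ((j : ZMod m) * t).val % p :=
      Nat.eq_of_mul_eq_mul_left (Nat.pos_of_ne_zero hd0) h1
    rw [ZMod.val_mul, ZMod.val_mul, Nat.mod_mod_of_dvd _ hpm, Nat.mod_mod_of_dvd _ hpm,
      hcast i hi, hcast j hj] at h2
    have h3 : i ≡ j [MOD p] := Nat.ModEq.cancel_right_of_coprime htcop.symm h2
    exact Nat.ModEq.eq_of_lt_of_lt h3 hi hj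
  -- cardinalities
  have hcardT : Multiset.card T = p := by rw [hT, Multiset.card_map, Multiset.card_range]
  have hcardF : (Finset.univ.filter fun x : ZMod m ↦ x.val % (m / p) = b.val % (m / p)).card = p := by
    have h := KoblitzOgus.sum_fiber_eq_sum_range hdm b (fun _ ↦ (1 : ℕ))
    simpa [hmd] using h
  refine Multiset.eq_of_le_of_card_le ((Multiset.le_iff_subset hnodup).mpr fun x hx ↦ hmem x hx) ?_
  rw [Finset.card_val, hcardF, hcardT]

open Literature.NumberTheory.Transcendental in
/-- `∑ ⟨x⟩` over the fibre `{x ≡ b (mod d)}` of `ℤ/m`, `d = m/p`: its elements are `r + j d`,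
`j < p`, `r = ⟨b⟩ mod d`, so the sum is `p r + d (0 + 1 + ⋯ + (p-1))`. [folklore] -/
theorem sum_val_filter_of_dvd {m p : ℕ} [NeZero m] (hpm : p ∣ m) (b : ZMod m) :
    ∑ x ∈ Finset.univ.filter (fun x : ZMod m ↦ x.val % (m / p) = b.val % (m / p)), x.val =
      p * (b.val % (m / p)) + (m / p) * ∑ j ∈ Finset.range p, j := by
  have hm0 : m ≠ 0 := NeZero.ne m
  have hpd : p * (m / p) = m := Nat.mul_div_cancel' hpm
  have hd0 : m / p ≠ 0 := fun h ↦ hm0 (by rw [← hpd, h, mul_zero])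
  have hdm : m / p ∣ m := Dvd.intro_left p hpd
  have hmd : m / (m / p) = p := Nat.div_eq_of_eq_mul_left (Nat.pos_of_ne_zero hd0) hpd.symm
  rw [KoblitzOgus.sum_fiber_eq_sum_range hdm b ZMod.val, hmd]
  have hval : ∀ j ∈ Finset.range p,
      (((b.val % (m / p) + j * (m / p) : ℕ) : ZMod m)).val = b.val % (m / p) + j * (m / p) := by
    intro j hj
    refine ZMod.val_natCast_of_lt (KoblitzOgus.mod_add_mul_lt hdm b ?_)
    rw [hmd]; exact Finset.mem_range.mp hj
  rw [Finset.sum_congr rfl hval, Finset.sum_add_distrib, Finset.sum_const, Finset.card_range,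
    smul_eq_mul, Finset.mul_sum]
  congr 1
  exact Finset.sum_congr rfl fun j _ ↦ by ring

open Literature.NumberTheory.Transcendental in
/-- **Every standard element is a Hodge character (general degree).** For `p = 2r + 1` odd,
`p ∣ m`, `d = m/p`, and `a ∈ ℤ/m` with `p a ≠ 0` (i.e. `d ∤ ⟨a⟩`), Aoki's `p`-standard multiset
`σ_{p,a} = {a, a + d, …, a + (p-1) d, -pa}` is a Hodge multiset: all entries non-zero, sum zero,
and `Σ ⟨t x⟩ = m (p+1)/2` for every unit `t` — the `t`-twist of the progression is the coset
`{r, r + d, …, r + (p-1) d}`, `r = ⟨ta⟩ mod d`, of sum `p r + d p(p-1)/2`, and `⟨-p t a⟩ = m - p r`.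
(Aoki 1983, Prop. 5.1: "Every standard element belongs to `B_m`", proof referred to Koblitz–Ogus;
the spelling is the multiset hypothesis of the tree's `Aoki1987_claim_pStandard`.)
[cite: Aoki1983, §5 Prop. 5.1 (p. 36)] [cite: Aoki1987, §1 p. 387] -/
theorem isHodgeMultiset_pStandard {m p r : ℕ} [NeZero m] (hp : p = 2 * r + 1) (hpm : p ∣ m)
    {a : ZMod m} (ha : (p : ZMod m) * a ≠ 0) :
    IsHodgeMultiset ((Multiset.range p).map (fun i : ℕ ↦ a + (i : ZMod m) * ((m / p : ℕ) : ZMod m)) +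
      {-((p : ZMod m) * a)}) := by
  classical
  have hm0 : m ≠ 0 := NeZero.ne m
  have hpd : p * (m / p) = m := Nat.mul_div_cancel' hpm
  have hd0 : m / p ≠ 0 := fun h ↦ hm0 (by rw [← hpd, h, mul_zero])
  have hdm : m / p ∣ m := Dvd.intro_left p hpd
  have hmd : m / (m / p) = p := Nat.div_eq_of_eq_mul_left (Nat.pos_of_ne_zero hd0) hpd.symm
  have hpd0 : (p : ZMod m) * ((m / p : ℕ) : ZMod m) = 0 := by
    rw [← Nat.cast_mul, hpd, ZMod.natCast_self]
  have hvalp : ∀ y : ZMod m, ((p : ZMod m) * y).val = p * (y.val % (m / p)) := by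
    intro y
    have h := KoblitzOgus.val_div_mul hdm y
    rwa [hmd] at h
  have hS : (∑ i ∈ Finset.range p, i) = p * r := by
    apply Nat.eq_of_mul_eq_mul_right (show 0 < 2 by norm_num)
    rw [Finset.sum_range_id_mul_two, hp, Nat.add_sub_cancel]
    ring
  refine ⟨⟨?_, ?_⟩, fun t ↦ ?_⟩
  · -- all entries are non-zero
    intro x hx
    rw [Multiset.mem_add, Multiset.mem_singleton] at hx
    rcases hx with hx | rfl
    · obtain ⟨i, -, rfl⟩ := Multiset.mem_map.mp hx
      intro h0
      apply ha
      rw [eq_neg_of_add_eq_zero_left h0]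
      calc (p : ZMod m) * -((i : ZMod m) * ((m / p : ℕ) : ZMod m))
          = -((i : ZMod m) * ((p : ZMod m) * ((m / p : ℕ) : ZMod m))) := by ring
        _ = 0 := by rw [hpd0, mul_zero, neg_zero]
    · exact neg_ne_zero.mpr ha
  · -- the entries sum to zero (`p` odd)
    rw [Multiset.sum_add, Multiset.sum_singleton, ← Finset.range_val, ← Finset.sum_eq_multiset_sum,
      Finset.sum_add_distrib, Finset.sum_const, Finset.card_range, nsmul_eq_mul, ← Finset.sum_mul,
      ← Nat.cast_sum, hS]
    have h3 : ((p * r : ℕ) : ZMod m) * ((m / p : ℕ) : ZMod m) = 0 := by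
      rw [← Nat.cast_mul, show p * r * (m / p) = r * m by rw [mul_comm p r, mul_assoc, hpd],
        Nat.cast_mul, ZMod.natCast_self, mul_zero]
    rw [h3, add_zero, add_neg_cancel]
  · -- the norm condition for every unit `t`
    set b : ZMod m := (t : ZMod m) * a with hb
    have hpb : (p : ZMod m) * b ≠ 0 := by
      rw [hb, mul_left_comm]
      exact fun h ↦ ha ((Units.mul_right_eq_zero t).mp h)
    have hmap : ((Multiset.range p).map (fun i : ℕ ↦ a + (i : ZMod m) * ((m / p : ℕ) : ZMod m)) +
          {-((p : ZMod m) * a)}).map (fun x ↦ (t : ZMod m) * x) =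
        (Multiset.range p).map
            (fun i : ℕ ↦ b + (i : ZMod m) * ((t : ZMod m) * ((m / p : ℕ) : ZMod m))) +
          {-((p : ZMod m) * b)} := by
      rw [Multiset.map_add, Multiset.map_singleton, Multiset.map_map]
      congr 1
      · exact Multiset.map_congr rfl fun i _ ↦ by simp only [Function.comp_apply, hb]; ring
      · rw [hb]; congr 1; ring
    have hcard : Multiset.card ((Multiset.range p).map
          (fun i : ℕ ↦ a + (i : ZMod m) * ((m / p : ℕ) : ZMod m)) + {-((p : ZMod m) * a)}) = p + 1 := by
      rw [Multiset.card_add, Multiset.card_map, Multiset.card_range, Multiset.card_singleton]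
    rw [hcard, hmap, mNormSum_add, range_map_eq_filter_of_dvd hpm b t]
    have hnorm1 : mNormSum (Finset.univ.filter fun x : ZMod m ↦ x.val % (m / p) = b.val % (m / p)).val
        = p * (b.val % (m / p)) + (m / p) * (p * r) := by
      rw [← hS, ← sum_val_filter_of_dvd hpm b]
      exact (Finset.sum_eq_multiset_sum _ _).symm
    have hnorm2 : mNormSum ({-((p : ZMod m) * b)} : Multiset (ZMod m)) = m - p * (b.val % (m / p)) := by
      simp only [mNormSum, Multiset.map_singleton, Multiset.sum_singleton]
      rw [ZMod.neg_val, if_neg hpb, hvalp]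
    rw [hnorm1, hnorm2]
    have hρ : p * (b.val % (m / p)) ≤ m := by
      calc p * (b.val % (m / p)) ≤ p * (m / p) :=
            Nat.mul_le_mul_left p (Nat.mod_lt _ (Nat.pos_of_ne_zero hd0)).le
        _ = m := hpd
    rw [add_right_comm, Nat.add_sub_cancel' hρ,
      show (m / p) * (p * r) = m * r by rw [← mul_assoc, mul_comm (m / p) p, hpd], hp]
    ring


/-- The progression `{b, b + d, …, b + (p-1) d}` itself (`t = 1`) is the fibre of reduction mod `d`.
[cite: Aoki1987, §1 p. 387] -/
theorem range_map_eq_filter_of_dvd_one {m p : ℕ} [NeZero m] (hpm : p ∣ m) (b : ZMod m) :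
    (Multiset.range p).map (fun i : ℕ ↦ b + (i : ZMod m) * ((m / p : ℕ) : ZMod m)) =
      (Finset.univ.filter fun x : ZMod m ↦ x.val % (m / p) = b.val % (m / p)).val := by
  simpa using range_map_eq_filter_of_dvd hpm b 1

end GeneralDegree

/-! ### General degree `m = 5d`, `(d, 6) = 1`, `d > 1`: the `5`-standard sextuples of `X⁴ₘ` -/

section FiveStandardGeneral

variable {m : ℕ} [NeZero m]

omit [NeZero m] in
/-- The route spelling `{a, a + d, a + 2d, a + 3d, a + 4d, -(5a)}` of the `5`-standard sextuple is
Aoki's `σ_{5,a} = {a + k d : k < 5} + {-5a}`. [cite: Aoki1987, §1 p. 387] -/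
theorem fiveStandard_eq_range_map (a : ZMod m) :
    ({a, a + ((m / 5 : ℕ) : ZMod m), a + 2 * ((m / 5 : ℕ) : ZMod m), a + 3 * ((m / 5 : ℕ) : ZMod m),
        a + 4 * ((m / 5 : ℕ) : ZMod m), -(5 * a)} : Multiset (ZMod m)) =
      (Multiset.range 5).map (fun i : ℕ ↦ a + (i : ZMod m) * ((m / 5 : ℕ) : ZMod m)) +
        {-(((5 : ℕ) : ZMod m) * a)} := by
  have hr : Multiset.range 5 = {0, 1, 2, 3, 4} := by decide
  rw [hr]
  simp only [Multiset.insert_eq_cons, Multiset.map_cons, Multiset.map_singleton, Nat.cast_ofNat,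
    Nat.cast_one, Nat.cast_zero, one_mul, zero_mul, add_zero, Multiset.cons_add,
    Multiset.singleton_add]

/-- **The `5`-standard sextuples are Hodge characters of the Fermat fourfold `X⁴ₘ` for EVERY degree
`m` divisible by `5`** (and every `a` with `5a ≠ 0`, i.e. `d ∤ ⟨a⟩`, `d = m/5`): the case
`p = 5` of `isHodgeMultiset_pStandard`, in the spelling of the route items `K3Exhaustion` /
`ShiodaAokiSupply` of `Theses/DerivedTorelliFermat`. For `m = 25, 35` this is
`isHodgeMultiset_fiveStandard_twentyfive/thirtyfive` above (by `decide`); here for all `m`.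
[cite: Aoki1983, §5 Prop. 5.1 (p. 36) and §7 proof of Thm. A′ (p. 43: σ_{p,1} ∈ 𝔅ⁿₘ ∖ 𝔇ⁿₘ)]
[cite: Aoki1987, §1 p. 387] -/
theorem isHodgeMultiset_fiveStandard (h5 : 5 ∣ m) {a : ZMod m} (ha : (5 : ZMod m) * a ≠ 0) :
    IsHodgeMultiset ({a, a + ((m / 5 : ℕ) : ZMod m), a + 2 * ((m / 5 : ℕ) : ZMod m),
      a + 3 * ((m / 5 : ℕ) : ZMod m), a + 4 * ((m / 5 : ℕ) : ZMod m), -(5 * a)} : Multiset (ZMod m)) := by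
  rw [fiveStandard_eq_range_map]
  exact isHodgeMultiset_pStandard (p := 5) (r := 2) rfl h5 (by simpa using ha)

/-- `5a ≠ 0` in `ℤ/m` when `(⟨a⟩, d) = 1` and `d = m/5 > 1` (`⟨5a⟩ = 5 (⟨a⟩ mod d)`).
[cite: Aoki1987, §1 p. 387 (the side condition d/(i,d) > 2)] -/
theorem five_mul_ne_zero_of_coprime (h5 : 5 ∣ m) (hd1 : 1 < m / 5) {a : ZMod m}
    (ha : Nat.Coprime a.val (m / 5)) : (5 : ZMod m) * a ≠ 0 := by
  have hpd : 5 * (m / 5) = m := Nat.mul_div_cancel' h5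
  have hdm : m / 5 ∣ m := Dvd.intro_left 5 hpd
  have hmd : m / (m / 5) = 5 := Nat.div_eq_of_eq_mul_left (by omega) hpd.symm
  intro h0
  have h := Literature.NumberTheory.Transcendental.KoblitzOgus.val_div_mul hdm a
  rw [hmd, Nat.cast_ofNat, h0, ZMod.val_zero] at h
  have hmod : a.val % (m / 5) = 0 := by omega
  have hdvd : m / 5 ∣ a.val := Nat.dvd_of_mod_eq_zero hmod
  have : m / 5 = 1 := Nat.Coprime.eq_one_of_dvd ha.symm hdvd
  omega

/-- `d ∣ c` and `c ∣ 36` force `d = 1` when `(d, 6) = 1`. [folklore] -/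
private theorem eq_one_of_dvd_of_coprime_six {d c : ℕ} (hd6 : Nat.Coprime d 6) (hdc : d ∣ c)
    (hc : c ∣ 36) : d = 1 :=
  Nat.Coprime.eq_one_of_dvd (by simpa using hd6.pow_right 2) (hdc.trans hc)

/-- Reduction mod `d`: if `c · ā = 0` in `ℤ/d` (`ā = a mod d`, `(⟨a⟩, d) = 1`) then `d ∣ c`. [folklore] -/
private theorem dvd_of_natCast_mul_castHom_eq_zero {d : ℕ} (hdm : d ∣ m) {a : ZMod m}
    (ha : Nat.Coprime a.val d) {c : ℕ} (h : (c : ZMod d) * ZMod.castHom hdm (ZMod d) a = 0) :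
    d ∣ c := by
  rw [ZMod.castHom_apply, ZMod.cast_eq_val, ← Nat.cast_mul, ZMod.natCast_eq_zero_iff] at h
  exact ha.symm.dvd_of_dvd_mul_right h

omit [NeZero m] in
/-- The elements of the `5`-standard sextuple: five points of the coset `a + d ℤ/m` and `-5a`.
[cite: Aoki1987, §1 p. 387] -/
private theorem mem_fiveStandard {a x : ZMod m}
    (hx : x ∈ ({a, a + ((m / 5 : ℕ) : ZMod m), a + 2 * ((m / 5 : ℕ) : ZMod m),
      a + 3 * ((m / 5 : ℕ) : ZMod m), a + 4 * ((m / 5 : ℕ) : ZMod m), -(5 * a)} : Multiset (ZMod m))) :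
    (∃ c : ZMod m, x = a + c * ((m / 5 : ℕ) : ZMod m)) ∨ x = -(5 * a) := by
  simp only [Multiset.insert_eq_cons, Multiset.mem_cons, Multiset.mem_singleton] at hx
  rcases hx with rfl | rfl | rfl | rfl | rfl | rfl
  · exact Or.inl ⟨0, by ring⟩
  · exact Or.inl ⟨1, by ring⟩
  · exact Or.inl ⟨2, by ring⟩
  · exact Or.inl ⟨3, by ring⟩
  · exact Or.inl ⟨4, by ring⟩
  · exact Or.inr rfl

/-- **No two distinct entries of a `5`-standard sextuple sum to zero** when `d = m/5 > 1` is coprime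
to `6` and `(⟨a⟩, d) = 1`: reducing mod `d` (where `d ↦ 0`, `a ↦ ā` a unit), `(a + id) + (a + jd) ↦ 2ā`
and `(a + id) - 5a ↦ -4ā`, both non-zero. (For `d` even or `d ∣ 4`, e.g. `m = 10, 20`, pairs do occur.)
[cite: Aoki1983, §7 p. 43 (σ_{p,1} ∉ 𝔇)] -/
theorem fiveStandard_add_ne_zero (h5 : 5 ∣ m) (hd6 : Nat.Coprime (m / 5) 6) (hd1 : 1 < m / 5)
    {a : ZMod m} (ha : Nat.Coprime a.val (m / 5)) {x x' : ZMod m}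
    (hx : x ∈ ({a, a + ((m / 5 : ℕ) : ZMod m), a + 2 * ((m / 5 : ℕ) : ZMod m),
      a + 3 * ((m / 5 : ℕ) : ZMod m), a + 4 * ((m / 5 : ℕ) : ZMod m), -(5 * a)} : Multiset (ZMod m)))
    (hx' : x' ∈ ({a, a + ((m / 5 : ℕ) : ZMod m), a + 2 * ((m / 5 : ℕ) : ZMod m),
      a + 3 * ((m / 5 : ℕ) : ZMod m), a + 4 * ((m / 5 : ℕ) : ZMod m), -(5 * a)} : Multiset (ZMod m)))
    (hne : x ≠ x') : x + x' ≠ 0 := by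
  have hpd : 5 * (m / 5) = m := Nat.mul_div_cancel' h5
  have hdm : m / 5 ∣ m := Dvd.intro_left 5 hpd
  set φ := ZMod.castHom hdm (ZMod (m / 5)) with hφ
  have hφD : φ ((m / 5 : ℕ) : ZMod m) = 0 := by rw [map_natCast, ZMod.natCast_self]
  have key : ∀ c : ℕ, (c : ZMod (m / 5)) * φ a = 0 → c ∣ 36 → False := fun c hc h36 ↦
    absurd (eq_one_of_dvd_of_coprime_six hd6 (dvd_of_natCast_mul_castHom_eq_zero hdm ha hc) h36)
      hd1.ne'
  have hφprog : ∀ c : ZMod m, φ (a + c * ((m / 5 : ℕ) : ZMod m)) = φ a := fun c ↦ by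
    rw [_root_.map_add, _root_.map_mul, hφD, mul_zero, add_zero]
  have hφy : φ (-(5 * a)) = -(5 * φ a) := by rw [_root_.map_neg, _root_.map_mul, map_ofNat]
  intro h0
  have hφ0 : φ x + φ x' = 0 := by rw [← _root_.map_add, h0, _root_.map_zero]
  rcases mem_fiveStandard hx with ⟨c, rfl⟩ | rfl <;>
    rcases mem_fiveStandard hx' with ⟨c', rfl⟩ | rfl
  · rw [hφprog, hφprog] at hφ0
    refine key 2 ?_ (by norm_num)
    push_cast
    linear_combination hφ0
  · rw [hφprog, hφy] at hφ0
    refine key 4 ?_ (by norm_num)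
    push_cast
    linear_combination -hφ0
  · rw [hφy, hφprog] at hφ0
    refine key 4 ?_ (by norm_num)
    push_cast
    linear_combination -hφ0
  · exact hne rfl

/-- **No three distinct entries of a `5`-standard sextuple sum to zero** (same hypotheses): mod `d`
the sum of three entries is `3ā` or `2ā - 5ā = -3ā`. [cite: Aoki1983, §7 p. 43] -/
theorem fiveStandard_add_add_ne_zero (h5 : 5 ∣ m) (hd6 : Nat.Coprime (m / 5) 6) (hd1 : 1 < m / 5)
    {a : ZMod m} (ha : Nat.Coprime a.val (m / 5)) {x x' x'' : ZMod m}
    (hx : x ∈ ({a, a + ((m / 5 : ℕ) : ZMod m), a + 2 * ((m / 5 : ℕ) : ZMod m),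
      a + 3 * ((m / 5 : ℕ) : ZMod m), a + 4 * ((m / 5 : ℕ) : ZMod m), -(5 * a)} : Multiset (ZMod m)))
    (hx' : x' ∈ ({a, a + ((m / 5 : ℕ) : ZMod m), a + 2 * ((m / 5 : ℕ) : ZMod m),
      a + 3 * ((m / 5 : ℕ) : ZMod m), a + 4 * ((m / 5 : ℕ) : ZMod m), -(5 * a)} : Multiset (ZMod m)))
    (hx'' : x'' ∈ ({a, a + ((m / 5 : ℕ) : ZMod m), a + 2 * ((m / 5 : ℕ) : ZMod m),
      a + 3 * ((m / 5 : ℕ) : ZMod m), a + 4 * ((m / 5 : ℕ) : ZMod m), -(5 * a)} : Multiset (ZMod m)))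
    (h12 : x ≠ x') (h13 : x ≠ x'') (h23 : x' ≠ x'') : x + x' + x'' ≠ 0 := by
  have hpd : 5 * (m / 5) = m := Nat.mul_div_cancel' h5
  have hdm : m / 5 ∣ m := Dvd.intro_left 5 hpd
  set φ := ZMod.castHom hdm (ZMod (m / 5)) with hφ
  have hφD : φ ((m / 5 : ℕ) : ZMod m) = 0 := by rw [map_natCast, ZMod.natCast_self]
  have key : ∀ c : ℕ, (c : ZMod (m / 5)) * φ a = 0 → c ∣ 36 → False := fun c hc h36 ↦
    absurd (eq_one_of_dvd_of_coprime_six hd6 (dvd_of_natCast_mul_castHom_eq_zero hdm ha hc) h36)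
      hd1.ne'
  have hφprog : ∀ c : ZMod m, φ (a + c * ((m / 5 : ℕ) : ZMod m)) = φ a := fun c ↦ by
    rw [_root_.map_add, _root_.map_mul, hφD, mul_zero, add_zero]
  have hφy : φ (-(5 * a)) = -(5 * φ a) := by rw [_root_.map_neg, _root_.map_mul, map_ofNat]
  intro h0
  have hφ0 : φ x + φ x' + φ x'' = 0 := by
    rw [← _root_.map_add, ← _root_.map_add, h0, _root_.map_zero]
  rcases mem_fiveStandard hx with ⟨c, rfl⟩ | rfl <;>
    rcases mem_fiveStandard hx' with ⟨c', rfl⟩ | rfl <;>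
      rcases mem_fiveStandard hx'' with ⟨c'', rfl⟩ | rfl
  · rw [hφprog, hφprog, hφprog] at hφ0
    refine key 3 ?_ (by norm_num)
    push_cast
    linear_combination hφ0
  · rw [hφprog, hφprog, hφy] at hφ0
    refine key 3 ?_ (by norm_num)
    push_cast
    linear_combination -hφ0
  · rw [hφprog, hφy, hφprog] at hφ0
    refine key 3 ?_ (by norm_num)
    push_cast
    linear_combination -hφ0
  · exact h23 rfl
  · rw [hφy, hφprog, hφprog] at hφ0
    refine key 3 ?_ (by norm_num)
    push_cast
    linear_combination -hφ0
  · exact h13 rfl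
  · exact h12 rfl
  · exact h12 rfl

/-- **The `5`-standard sextuple has six distinct entries** (same hypotheses): the progression is the
fibre of reduction mod `d` (duplicate-free) and `-5a` is not in it (`-5ā ≠ ā` as `6ā ≠ 0`).
[cite: Aoki1987, §1 p. 387] -/
theorem nodup_fiveStandard (h5 : 5 ∣ m) (hd6 : Nat.Coprime (m / 5) 6) (hd1 : 1 < m / 5)
    {a : ZMod m} (ha : Nat.Coprime a.val (m / 5)) :
    ({a, a + ((m / 5 : ℕ) : ZMod m), a + 2 * ((m / 5 : ℕ) : ZMod m), a + 3 * ((m / 5 : ℕ) : ZMod m),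
      a + 4 * ((m / 5 : ℕ) : ZMod m), -(5 * a)} : Multiset (ZMod m)).Nodup := by
  classical
  have hpd : 5 * (m / 5) = m := Nat.mul_div_cancel' h5
  have hdm : m / 5 ∣ m := Dvd.intro_left 5 hpd
  rw [fiveStandard_eq_range_map, Multiset.nodup_add]
  refine ⟨?_, Multiset.nodup_singleton _, ?_⟩
  · rw [range_map_eq_filter_of_dvd_one h5 a]
    exact Finset.nodup _
  · rw [Multiset.disjoint_singleton]
    intro hy
    obtain ⟨i, -, hi⟩ := Multiset.mem_map.mp hy
    set φ := ZMod.castHom hdm (ZMod (m / 5)) with hφ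
    have hφD : φ ((m / 5 : ℕ) : ZMod m) = 0 := by rw [map_natCast, ZMod.natCast_self]
    have e := congrArg φ hi
    rw [_root_.map_add, _root_.map_mul, hφD, mul_zero, add_zero, _root_.map_neg, _root_.map_mul,
      map_natCast] at e
    have h6 : ((6 : ℕ) : ZMod (m / 5)) * φ a = 0 := by
      push_cast at e ⊢
      linear_combination e
    exact absurd (eq_one_of_dvd_of_coprime_six hd6
      (dvd_of_natCast_mul_castHom_eq_zero hdm ha h6) (by norm_num)) hd1.ne'

/-- **`σ_{5,a}` is not decomposable** for every `m = 5d` with `(d, 6) = 1`, `d > 1`, `(⟨a⟩, d) = 1`: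
a decomposition `σ = ξ' + ξ''` into non-empty Hodge multisets has a part of cardinality `2`, i.e.
a pair `{x, -x} ≤ σ`, excluded by `fiveStandard_add_ne_zero` (`x ≠ -x` as `σ` is duplicate-free).
In particular this holds for every `m ≥ 25` coprime to `6` with `5 ∣ m` (Aoki 1983, §7:
`σ_{5,1} ∈ 𝔅⁴ₘ ∖ 𝔇⁴ₘ`, so `𝔅⁴ₘ ≠ 𝔇⁴ₘ` — the necessity half of Thm. A′ for `n = 4`).
[cite: Aoki1983, Thm. A′ (p. 43) and its proof, §7] [cite: Shioda1979PJA, §1 Definition (i)] -/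
theorem not_isDecomposable_fiveStandard (h5 : 5 ∣ m) (hd6 : Nat.Coprime (m / 5) 6)
    (hd1 : 1 < m / 5) {a : ZMod m} (ha : Nat.Coprime a.val (m / 5)) :
    ¬ IsDecomposable ({a, a + ((m / 5 : ℕ) : ZMod m), a + 2 * ((m / 5 : ℕ) : ZMod m),
      a + 3 * ((m / 5 : ℕ) : ZMod m), a + 4 * ((m / 5 : ℕ) : ZMod m), -(5 * a)} : Multiset (ZMod m)) := by
  classical
  rintro ⟨t, u, ht0, hu0, ht, hu, hs⟩
  have hnd := nodup_fiveStandard h5 hd6 hd1 ha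
  -- a Hodge part of cardinality `2`, i.e. a pair `{x, -x} ≤ σ`
  have hcard : Multiset.card t + Multiset.card u = 6 := by
    rw [← Multiset.card_add, ← hs]; rfl
  obtain ⟨x, -, hxle⟩ : ∃ x : ZMod m, x ≠ 0 ∧ ({x, -x} : Multiset (ZMod m)) ≤ t + u := by
    obtain ⟨k, hk⟩ := ht.even_card
    obtain ⟨l, hl⟩ := hu.even_card
    have h2t := ht.two_le_card ht0
    have h2u := hu.two_le_card hu0
    by_cases htc : Multiset.card t = 2
    · obtain ⟨x, hx0, rfl⟩ := ht.eq_pair_of_card_eq_two htc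
      exact ⟨x, hx0, Multiset.le_add_right _ _⟩
    · have huc : Multiset.card u = 2 := by omega
      obtain ⟨x, hx0, rfl⟩ := hu.eq_pair_of_card_eq_two huc
      exact ⟨x, hx0, Multiset.le_add_left _ _⟩
  rw [← hs] at hxle
  have hsub := Multiset.subset_of_le hxle
  have hx : x ∈ _ := hsub (Multiset.mem_cons_self x _)
  have hx' : -x ∈ _ := hsub (Multiset.mem_cons_of_mem (Multiset.mem_singleton_self _))
  have hne : x ≠ -x := by
    have hn := Multiset.nodup_of_le hxle hnd
    rw [Multiset.insert_eq_cons, Multiset.nodup_cons, Multiset.mem_singleton] at hn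
    exact hn.1
  exact fiveStandard_add_ne_zero h5 hd6 hd1 ha hx hx' hne (add_neg_cancel x)

/-- **`σ_{5,a}` is not semi-decomposable** (same hypotheses): it contains no zero-sum triple
(`fiveStandard_add_add_ne_zero`). With `not_isDecomposable_fiveStandard`: for every `m = 5d`,
`(d, 6) = 1`, `d > 1`, the Hodge characters `σ_{5,a}` of `X⁴ₘ` are reached by NEITHER of the two
decomposition types of Shioda's condition that do not pass through `𝔅²ₘ × 𝔅²ₘ` — cf. the module
docstring: da Silva's proof of his Thm. 3.3 covers only `(P⁴ₘ)`-type characters; quasi-decomposability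
of `σ_{5,a}` is excluded above for `m = 25, 35` by computation and in general would follow from
`𝔅²ₘ = 𝔇²ₘ` for `(m, 6) = 1` (Aoki 1983, Thm. A′ with `n = 2`), which is not formalised here.
[cite: Shioda1979PJA, §1 Definition (iii)] [cite: Aoki1983, Thm. A′ (p. 43)] -/
theorem not_isSemiDecomposable_fiveStandard (h5 : 5 ∣ m) (hd6 : Nat.Coprime (m / 5) 6)
    (hd1 : 1 < m / 5) {a : ZMod m} (ha : Nat.Coprime a.val (m / 5)) :
    ¬ IsSemiDecomposable ({a, a + ((m / 5 : ℕ) : ZMod m), a + 2 * ((m / 5 : ℕ) : ZMod m),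
      a + 3 * ((m / 5 : ℕ) : ZMod m), a + 4 * ((m / 5 : ℕ) : ZMod m), -(5 * a)} : Multiset (ZMod m)) := by
  classical
  rintro ⟨t, u, ht3, -, ht0, -, hs⟩
  have hnd := nodup_fiveStandard h5 hd6 hd1 ha
  obtain ⟨x, x', x'', rfl⟩ := Multiset.card_eq_three.mp ht3
  have hle : ({x, x', x''} : Multiset (ZMod m)) ≤ _ := hs ▸ Multiset.le_add_right _ _
  have hsub := Multiset.subset_of_le hle
  have hn := Multiset.nodup_of_le hle hnd
  simp only [Multiset.insert_eq_cons, Multiset.nodup_cons, Multiset.mem_cons, Multiset.mem_singleton,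
    not_or, Multiset.nodup_singleton, and_true] at hn
  have hx : x ∈ _ := hsub (by simp)
  have hx' : x' ∈ _ := hsub (by simp)
  have hx'' : x'' ∈ _ := hsub (by simp)
  have hsum : x + x' + x'' = 0 := by
    simpa [Multiset.insert_eq_cons, add_assoc] using ht0
  exact fiveStandard_add_add_ne_zero h5 hd6 hd1 ha hx hx' hx'' hn.1.1 hn.1.2 hn.2 hsum

/-- **Degrees coprime to `6`**: for every `m` with `5 ∣ m`, `(m, 6) = 1`, `m ≠ 5`, and every `a`
with `(⟨a⟩, m/5) = 1`, the `5`-standard sextuple `σ_{5,a}` is a Hodge character of `X⁴ₘ` which is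
neither decomposable nor semi-decomposable — the family behind `m = 25, 35` above (where, in
addition, quasi-decomposability was excluded by computation). [cite: Aoki1983, Thm. A′ (p. 43), §7]
[cite: daSilva2021HodgeFermat, §2 (remark before Thm. 2.8) and Thm. 3.3] -/
theorem fiveStandard_hodge_not_decomposable_of_coprime_six (h5 : 5 ∣ m) (h6 : Nat.Coprime m 6)
    (hm5 : m ≠ 5) {a : ZMod m} (ha : Nat.Coprime a.val (m / 5)) :
    IsHodgeMultiset ({a, a + ((m / 5 : ℕ) : ZMod m), a + 2 * ((m / 5 : ℕ) : ZMod m),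
        a + 3 * ((m / 5 : ℕ) : ZMod m), a + 4 * ((m / 5 : ℕ) : ZMod m), -(5 * a)} : Multiset (ZMod m)) ∧
      ¬ IsDecomposable ({a, a + ((m / 5 : ℕ) : ZMod m), a + 2 * ((m / 5 : ℕ) : ZMod m),
        a + 3 * ((m / 5 : ℕ) : ZMod m), a + 4 * ((m / 5 : ℕ) : ZMod m), -(5 * a)} : Multiset (ZMod m)) ∧
      ¬ IsSemiDecomposable ({a, a + ((m / 5 : ℕ) : ZMod m), a + 2 * ((m / 5 : ℕ) : ZMod m),
        a + 3 * ((m / 5 : ℕ) : ZMod m), a + 4 * ((m / 5 : ℕ) : ZMod m), -(5 * a)} : Multiset (ZMod m)) := by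
  have hpd : 5 * (m / 5) = m := Nat.mul_div_cancel' h5
  have hdm : m / 5 ∣ m := Dvd.intro_left 5 hpd
  have hd6 : Nat.Coprime (m / 5) 6 := h6.coprime_dvd_left hdm
  have hd1 : 1 < m / 5 := by
    have hm0 : m ≠ 0 := NeZero.ne m
    rcases Nat.lt_or_ge 1 (m / 5) with h | h
    · exact h
    · exfalso
      interval_cases hmd : (m / 5)
      · omega
      · omega
  exact ⟨isHodgeMultiset_fiveStandard h5 (five_mul_ne_zero_of_coprime h5 hd1 ha),
    not_isDecomposable_fiveStandard h5 hd6 hd1 ha, not_isSemiDecomposable_fiveStandard h5 hd6 hd1 ha⟩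

end FiveStandardGeneral

end FermatCharacter

end Literature.AlgebraicGeometry.HodgeTheory
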